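import Summits.BirchSwinnertonDyer.BirchSwinnertonDyer.Theorems.AdditiveBranchIMCGordTwoRankZeroOffCaseOneFieldSupplyR0TameTwist
import Summits.BirchSwinnertonDyer.BirchSwinnertonDyer.Theorems.AdditiveBranchIMCGordTwoTwistedWanTwoDefs
import Literature.NumberTheory.EllipticCurves.YanZhu2026.TwistGoodOrdinaryProofs
import HarnessLib

/-!
# Route `AdditiveBranchIMC`, crux `GordTwoRankZeroOffCaseOne` (19357), line `three_field_road`, DOOR D («`ℓ₀ = 2` as the `K`-ramified twisted Wan
# prime», LeadReport27 §5): the cell (G-ord, `e = 2`) TRANSPORTS along the twist `Wd ≅ E^{(d_K)}` by an EVEN discriminant (LEAD g19; `--supports` 19357,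
# helper only)

Theorems only. The sibling of `ThreeFieldRoadSupply.cellGordTwo_tameTwist` (p-number in `…FieldSupplyR0TameTwist.lean`), whose hypothesis «`2` splits
in `K`» served only to make `d_K` odd square-free for the good-ordinary transport `isOrdinaryAt_of_smul_eq_quadraticTwist`; on the door-D road `2` is
RAMIFIED in `K` (`d_K = 4·t·n`), and the transport for an arbitrary fundamental discriminant is Yan–Zhu's
`isOrdinaryAt_of_smul_eq_quadraticTwist_discr` (the square factor `2²` is removed inside). `Addv` and `ord_p Δ_min` transport because `p` splits
(`d_K ∈ (ℚ_p^×)²`), as before.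
* `cellGordTwo_dyadicTwist` — `N10.CellGordTwo W p → N10.CellGordTwo Wd p` for `Wd = Cd • E^{(d_K)}`, `K` imaginary quadratic with `p ≥ 5` split (NO
  hypothesis at `2`);
* `cellGordTwo_of_tameRoadFieldTwistedTwo` — the same read off `TameRoadFieldTwistedTwo W p t K` (p819191).
References: [SilvermanAEC2009] X.5 Cor. 5.4, VII.5 Prop. 5.1; [YanZhu2026] (twist of a good ordinary curve by a fundamental discriminant prime to `p`).
presearch: n/a (kernel transport). BSD is proved for no curve.
-/

set_option linter.dupNamespace false

noncomputable section

open scoped Classical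

open WeierstrassCurve NumberField IsDedekindDomain
  Literature.NumberTheory.EllipticCurves
  Literature.NumberTheory.EllipticCurves.Rank1Residual
  Literature.NumberTheory.QuadraticFields
  Summit.BirchSwinnertonDyer.Rank1Residual
  Summit.BirchSwinnertonDyer.Rank1Residual.Additive
  Summit.BirchSwinnertonDyer.BirchSwinnertonDyer.Theorems

namespace Summit.BirchSwinnertonDyer.BirchSwinnertonDyer.Theorems.TwistedWanRoad

open ThreeFieldRoadSupply

section Transport

variable (W : WeierstrassCurve ℚ) [W.IsElliptic] [W.IsGloballyMinimal] (p : ℕ) [hp : Fact p.Prime]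
  (K : Type) [Field K] [NumberField K] {Wd : WeierstrassCurve ℚ} [Wd.IsElliptic] [Wd.IsGloballyMinimal]

/-- **Cell (G-ord, `e = 2`) transports along the twist by ANY imaginary quadratic discriminant with `p` split.** `p ≥ 5`, `K` imaginary quadratic
with `p` split (`2` may ramify), `Wd = Cd • E^{(d_K)}` globally minimal: `N10.CellGordTwo W p → N10.CellGordTwo Wd p`. `Addv` and `ord_p Δ_min` (hence
`e`) transport because `d_K ∈ (ℚ_p^×)²`; (G)-ordinary transports through the `p*`-partners: `V ≅ E^{(p*)}` is good ordinary, its twist by the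
fundamental discriminant `d_K` (prime to `p`) is good ordinary (`isOrdinaryAt_of_smul_eq_quadraticTwist_discr`), and that twist is a model of `Wd^{(p*)}`.
[cite: SilvermanAEC2009, X.5 Cor. 5.4 and VII.5 Prop. 5.1] -/
theorem cellGordTwo_dyadicTwist (hp5 : 5 ≤ p) (hK : IsImaginaryQuadratic K)
    (hpK : SatisfiesHeegnerHypothesis p K)
    (Cd : VariableChange ℚ) (hWd : Cd • W.quadraticTwist (NumberField.discr K : ℚ) = Wd)
    (hcell : N10.CellGordTwo W p) : N10.CellGordTwo Wd p := by
  have hp2 : p ≠ 2 := by omega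
  set d : ℤ := NumberField.discr K with hd_def
  have hdZ : d ≠ 0 := NumberField.discr_ne_zero K
  have hD0 : (d : ℚ) ≠ 0 := by exact_mod_cast hdZ
  obtain ⟨hsq, hpd⟩ := isSquare_and_not_dvd_of_split p K hK hp2 hpK
  obtain ⟨-, hadd, hG, he⟩ := hcell
  -- `Addv` and `ord_p Δ_min`
  have hsq' : IsSquare (((d : ℚ) : ℚ) : ℚ_[p]) := by simpa using hsq
  have haddd : Addv Wd p := (AdditivePotMult.addv_iff_of_twist hD0 hsq' Wd hWd).mpr hadd
  have hΔ : padicValInt p Wd.minimalDiscriminantInt = padicValInt p W.minimalDiscriminantInt :=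
    X11b.padicValInt_minimalDiscriminantInt_twist_eq W p hD0 hsq Cd hWd
  have hed : semistabilityIndex Wd p = 2 := by
    unfold semistabilityIndex at he ⊢
    rw [hΔ]
    exact he
  refine ⟨hp2, haddd, ?_, hed⟩
  -- (G)-ordinary via the `p*`-partners
  set ps : ℚ := (-1 : ℚ) ^ (p / 2) * p with hps
  have hps0 : ps ≠ 0 := mul_ne_zero (pow_ne_zero _ (by norm_num)) (by exact_mod_cast hp.out.ne_zero)
  obtain ⟨V, iV, iVm, CV, hCV⟩ := exists_isGloballyMinimal_smul_eq_quadraticTwist W hps0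
  have hV : CV⁻¹ • W.quadraticTwist ps = V := by rw [← hCV, inv_smul_smul]
  have hordV : GoodOrd V p := (typeGOrd_iff_goodOrd_twist_pStar W p hp5 he V CV⁻¹ hV).mp hG
  obtain ⟨Vd, iVd, iVdm, CVd, hCVd⟩ := exists_isGloballyMinimal_smul_eq_quadraticTwist V hD0
  have hordVd : IsOrdinaryAt Vd p :=
    isOrdinaryAt_of_smul_eq_quadraticTwist_discr hK.1 V Vd hCVd p hp2 hpd ⟨hordV.1, hordV.2⟩
  have hgoVd : GoodOrd Vd p := ⟨hordVd.1, hordVd.2⟩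
  -- `Vd` is a model of `Wd^{(p*)}`: `Wd^{(p*)} ≅ E^{(d_K p*)} ≅ (E^{(p*)})^{(d_K)} ≅ V^{(d_K)} ≅ Vd`
  have h1 : ∃ C : VariableChange ℚ, C • Wd.quadraticTwist ps = Vd := by
    have e1 : Wd.quadraticTwist ps =
        (⟨Cd.u, ps * Cd.r, 0, 0⟩ : VariableChange ℚ) • W.quadraticTwist ((d : ℚ) * ps) := by
      rw [← hWd, WeierstrassCurve.quadraticTwist_smul, quadraticTwist_quadraticTwist]
    have e2 : V.quadraticTwist (d : ℚ) =
        (⟨CV⁻¹.u, (d : ℚ) * CV⁻¹.r, 0, 0⟩ : VariableChange ℚ) • W.quadraticTwist (ps * (d : ℚ)) := by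
      rw [← hV, WeierstrassCurve.quadraticTwist_smul, quadraticTwist_quadraticTwist]
    refine ⟨CVd⁻¹ * (⟨CV⁻¹.u, (d : ℚ) * CV⁻¹.r, 0, 0⟩ : VariableChange ℚ) *
      (⟨Cd.u, ps * Cd.r, 0, 0⟩ : VariableChange ℚ)⁻¹, ?_⟩
    rw [mul_smul, mul_smul, e1, inv_smul_smul, mul_comm (d : ℚ) ps, ← e2, ← hCVd, inv_smul_smul]
  obtain ⟨C₃, hC₃⟩ := h1
  exact (typeGOrd_iff_goodOrd_twist_pStar Wd p hp5 hed Vd C₃ hC₃).mpr hgoVd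

/-- **Cell (G-ord, `e = 2`) transports along the door-D road field** (`TameRoadFieldTwistedTwo W p t K`: `K` imaginary quadratic, `p` split).
[cite: SilvermanAEC2009, X.5 Cor. 5.4 and VII.5 Prop. 5.1] -/
theorem cellGordTwo_of_tameRoadFieldTwistedTwo (hp5 : 5 ≤ p) {t : ℤ} (hK : TameRoadFieldTwistedTwo W p t K)
    (Cd : VariableChange ℚ) (hWd : Cd • W.quadraticTwist (NumberField.discr K : ℚ) = Wd)
    (hcell : N10.CellGordTwo W p) : N10.CellGordTwo Wd p :=
  cellGordTwo_dyadicTwist W p K hp5 hK.1 hK.2.2.2.2.2 Cd hWd hcell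

end Transport

end Summit.BirchSwinnertonDyer.BirchSwinnertonDyer.Theorems.TwistedWanRoad

end
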